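import Summits.NavierStokesRegularity.NavierStokesRegularity.Theorems.CriticalCoherenceDoorDefs
import Summits.NavierStokesRegularity.NavierStokesRegularity.Theorems.CriticalCoherenceDoorDepletion
import Summits.NavierStokesRegularity.NavierStokesRegularity.Theorems.CriticalCoherenceDoorRiesz
import Literature.Analysis.FluidPDE.VorticitySupEnstrophyGronwallSharp
import Literature.Analysis.FluidPDE.TaoEnstrophyLocalisationProofs
import HarnessLib

/-!
# CriticalCoherenceDoorStretching — door S33 «CriticalCoherenceDoor» (nsreg-p1 ROUND-31, texts
# `r31/Sketch33.lean` ae52fe0f17f630b4 = `Theorems/CriticalCoherenceDoorDefs.lean`), plate T33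

**`twoThresholdStretching_holds : TwoThresholdStretching`** — the TWO-THRESHOLD stretching estimate
(the one genuinely new estimate of the door): for `ν, Ω, η > 0` and real `Mh` there are `C₁, …, C₄ ≥ 0`,
chosen BEFORE the `x`-threshold, such that for every `Ωₓ > 0` and every admissible field `v` whose
vorticity directions satisfy the pair hypothesis for `|ω(x)| > Ωₓ`, `|ω(y)| > Ω`,
`2∫⟪ω,(∇v)ω⟫ ≤ ν∫|∇ω|²_F + ((2/√3)(1+η)Ωₓ + C₁ + C₂∫|ω|² + C₃∫|v|²)∫|ω|² + C₄∫|∇v|²_F`.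

Proof (ROUND-31 §1 (C) / PLATE-AID-33, with the weights `θₓ(2 − θₓ)` and `(1 − θₓ)²`): with
`θₓ = radialCutoff Ωₓ ((1+η)Ωₓ) (ω x)`, `Z = (1 − θₓ) ω`, `hi = (1 − θ_R(ω)) ω` (`R = 2Ω`, the tree's
`y`-split), `U = v − K ∗ hi`: `⟪ω,(∇v)ω⟫ = (1 − (1−θₓ)²)⟪ω,(∇v)ω⟫ + ⟪Z,(∇U)Z⟫ + ⟪Z,∇(K∗hi)Z⟫`.
LOW (`|ω(x)| < (1+η)Ωₓ` on the support of the weight `∈ [0,1]`): Chae's pointwise bound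
`two_mul_inner_curl_fderiv_le_of_divergence_eq_zero` ⇒ `(2/√3)(1+η)Ωₓ ∫|∇v|²_F ≤ (2/√3)(1+η)Ωₓ ∫|ω|²`
(`lintegral_frobeniusNormSq_fderiv_le_lintegral_sq_norm_curl`). `U`-TERM: integration by parts
(`abs_integral_inner_fderiv_apply_le_of_hasCompactSupport`) with the LAYER GRADIENT BOUND
`‖∇Z‖ ≤ (1 + C(1+η)/η)‖∇ω‖` (`norm_fderiv_xHighPart_le` — the `Ωₓ` CANCELS) and the sup bound
`exists_norm_sub_biotSavart_le` (sees `Ω` only). DEPLETED TERM: `exists_abs_inner_xHighPart_fderiv_biotSavart_highPart_le`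
+ `integral_le_of_depletedMajorant`. COUNT: the tree's `stretching_count_holder` with `T_E := 0`.
Every constant is a function of `(ν, Ω, Mh, η)` and absolute constants only.

HONEST FRAME: S33 is a regularity CRITERION (coherent scale-critical intense set ⇒ continuation),
Type-II-inclusive; nothing here bears on item 0056 `NoTypeII` or on NS regularity itself.
-/

noncomputable section

set_option linter.dupNamespace false

namespace Summit.NavierStokesRegularity.NavierStokesRegularity.Theorems.CriticalCoherenceDoor

open MeasureTheory Set Function Filter Metric Real InnerProductSpace
open _root_.Topology
open scoped ENNReal NNReal RealInnerProductSpace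
open Literature.Analysis Literature.Analysis.FluidPDE

-- nested operator types (second derivatives)
set_option maxSynthPendingDepth 3

set_option maxHeartbeats 3200000 in
/-- **Plate T33 «TwoThresholdStretching»** (two-threshold form of Beirão da Veiga–Berselli 2002,
Lemma 4.1 / Lemarié-Rieusset 2016, Thm. 11.7: the `x`-threshold `Ωₓ` enters ONLY through the displayed
low coefficient `(2/√3)(1+η)Ωₓ`). [folklore] -/
theorem twoThresholdStretching_holds : TwoThresholdStretching := by
  intro ν Ω Mh η hν hΩ hη
  -- universal constants
  obtain ⟨A, hA0, hdep⟩ := exists_abs_inner_xHighPart_fderiv_biotSavart_highPart_le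
  obtain ⟨Cb, Cv, hCb, hCv, hsup⟩ := exists_norm_sub_biotSavart_le
  obtain ⟨Cr, hCr0, hCr⟩ := exists_norm_fderiv_radialCutoff_le_div (E := EuclideanSpace ℝ (Fin 3))
  set K₀ : ℝ≥0 := SNormLESNormFDerivOfEqConst (EuclideanSpace ℝ (Fin 3))
    (volume : Measure (EuclideanSpace ℝ (Fin 3))) 2 with hK₀
  set K : ℝ := (K₀ : ℝ) + 1 with hK
  have hK0 : 0 < K := by rw [hK]; positivity
  -- the layer constant `1 + C (1+η)/η` (FREE OF `Ωₓ`)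
  set cθ : ℝ := 1 + Cr * (1 + η) / η with hcθ
  have hcθ0 : 0 ≤ cθ := by positivity
  set v₁ : ℝ := (volume : Measure (EuclideanSpace ℝ (Fin 3))).real (ball 0 1) with hv₁
  have hv₁0 : 0 ≤ v₁ := measureReal_nonneg
  set cn : ℝ := 6 * v₁ with hcn
  have hcn0 : 0 ≤ cn := by positivity
  set cf : ℝ := Real.sqrt (3 * v₁ / 2) with hcf
  have hcf0 : 0 ≤ cf := Real.sqrt_nonneg _
  set M : ℝ := max Mh 0 with hMdef'
  have hM0 : 0 ≤ M := le_max_right _ _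
  have hMhM : Mh ≤ M := le_max_left _ _
  refine ⟨8 * Ω + 2 / ν * 144 * cθ ^ 2 * (3 * (64 * Ω ^ 2)) + 2 * A * M * cf,
    2 / ν * 144 * cθ ^ 2 * (3 * Cb ^ 2) + 27 * (A * M * cn) ^ 4 * K ^ 6 / (2 * ν ^ 3) +
      4 * A * M * cf,
    2 / ν * 144 * cθ ^ 2 * (3 * Cv ^ 2), 8 * Ω, by positivity, by positivity, by positivity,
    by positivity, ?_⟩
  intro Ωx hΩx v hv hdiv hE hG hH hbd hdir
  obtain ⟨B, hB⟩ := hbd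
  -- ### basic objects
  have hv1 : ContDiff ℝ 1 v := hv.of_le (by norm_num)
  have hvc : Continuous v := hv.continuous
  have hDv : Continuous (fderiv ℝ v) := hv.continuous_fderiv (by norm_num)
  have hω1 : ContDiff ℝ 1 (curl v) := contDiff_curl (n := 1) (by exact hv)
  have hωc : Continuous (curl v) := hω1.continuous
  have hDω : Continuous (fderiv ℝ (curl v)) := hω1.continuous_fderiv one_ne_zero
  have hωle : ∀ x, ‖curl v x‖ ≤ ‖curlCLM‖ * ‖fderiv ℝ v x‖ := fun x => norm_curl_le v x
  have hDωle : ∀ x, ‖fderiv ℝ (curl v) x‖ ≤ ‖curlCLM‖ * ‖fderiv ℝ (fderiv ℝ v) x‖ := fun x => by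
    rw [fderiv_curl hv]
    exact ContinuousLinearMap.opNorm_comp_le _ _
  -- ### integrability
  have Iω : Integrable fun x => ‖curl v x‖ ^ 2 := by
    refine (hG.const_mul (‖curlCLM‖ ^ 2)).mono' ((hωc.norm.pow 2).aestronglyMeasurable)
      (Eventually.of_forall fun x => ?_)
    rw [Real.norm_of_nonneg (sq_nonneg _), ← mul_pow]
    exact pow_le_pow_left₀ (norm_nonneg _) (hωle x) 2
  have IDω : Integrable fun x => ‖fderiv ℝ (curl v) x‖ ^ 2 := by
    refine (hH.const_mul (‖curlCLM‖ ^ 2)).mono' ((hDω.norm.pow 2).aestronglyMeasurable)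
      (Eventually.of_forall fun x => ?_)
    rw [Real.norm_of_nonneg (sq_nonneg _), ← mul_pow]
    exact pow_le_pow_left₀ (norm_nonneg _) (hDωle x) 2
  have Ifv : Integrable fun x => frobeniusNormSq (fderiv ℝ v x) := by
    refine (hG.const_mul 3).mono' (continuous_frobeniusNormSq_fderiv hv (by norm_num)).aestronglyMeasurable
      (Eventually.of_forall fun x => ?_)
    rw [Real.norm_of_nonneg (frobeniusNormSq_nonneg _)]
    exact frobeniusNormSq_le_three_mul _
  have Ifω : Integrable fun x => frobeniusNormSq (fderiv ℝ (curl v) x) := by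
    refine (IDω.const_mul 3).mono' (continuous_frobeniusNormSq_fderiv hω1 one_ne_zero).aestronglyMeasurable
      (Eventually.of_forall fun x => ?_)
    rw [Real.norm_of_nonneg (frobeniusNormSq_nonneg _)]
    exact frobeniusNormSq_le_three_mul _
  -- ### the quantities
  set Y : ℝ := ∫ x, ‖curl v x‖ ^ 2 with hY
  set D : ℝ := ∫ x, frobeniusNormSq (fderiv ℝ (curl v) x) with hD
  set E : ℝ := ∫ x, ‖v x‖ ^ 2 with hEdef
  set F : ℝ := ∫ x, frobeniusNormSq (fderiv ℝ v x) with hF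
  set Dop : ℝ := ∫ x, ‖fderiv ℝ (curl v) x‖ ^ 2 with hDop
  have hY0 : 0 ≤ Y := integral_nonneg fun x => sq_nonneg _
  have hD0 : 0 ≤ D := integral_nonneg fun x => frobeniusNormSq_nonneg _
  have hE0 : 0 ≤ E := integral_nonneg fun x => sq_nonneg _
  have hF0 : 0 ≤ F := integral_nonneg fun x => frobeniusNormSq_nonneg _
  have hDopD : Dop ≤ D := integral_mono IDω Ifω fun x => sq_opNorm_le_frobeniusNormSq _
  set sY : ℝ := Real.sqrt Y with hsY
  set sD : ℝ := Real.sqrt D with hsD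
  set sE : ℝ := Real.sqrt E with hsE
  have hsY0 : 0 ≤ sY := Real.sqrt_nonneg _
  have hsD0 : 0 ≤ sD := Real.sqrt_nonneg _
  have hsE0 : 0 ≤ sE := Real.sqrt_nonneg _
  have hsY2 : sY ^ 2 = Y := Real.sq_sqrt hY0
  have hsE2 : sE ^ 2 = E := Real.sq_sqrt hE0
  have hsDop : Real.sqrt Dop ≤ sD := Real.sqrt_le_sqrt hDopD
  have hω2 : (eLpNorm (curl v) 2 volume).toReal = sY := toReal_eLpNorm_two_eq_sqrt hωc Iω
  have hv2 : (eLpNorm v 2 volume).toReal = sE := toReal_eLpNorm_two_eq_sqrt hvc hE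
  have hωm2 : MemLp (curl v) 2 volume := (memLp_two_iff_integrable_sq_norm hωc.aestronglyMeasurable).2 Iω
  -- `F ≤ Y` (`∫|∇v|²_F ≤ ∫|ω|²` for divergence-free `L²` fields)
  have hvl2 : ∫⁻ y, ‖v y‖ₑ ^ 2 < ⊤ := lintegral_enorm_sq_lt_top_of_integrable_sq hE
  have hFY : F ≤ Y := by
    have h := lintegral_frobeniusNormSq_fderiv_le_lintegral_sq_norm_curl hv hdiv hvl2
    have hFl : ENNReal.ofReal F = ∫⁻ x, ENNReal.ofReal (frobeniusNormSq (fderiv ℝ v x)) :=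
      ofReal_integral_eq_lintegral_ofReal Ifv (Eventually.of_forall fun x => frobeniusNormSq_nonneg _)
    have hYl : ∫⁻ x, ‖curl v x‖ₑ ^ 2 = ENNReal.ofReal Y := by
      rw [hY, ofReal_integral_eq_lintegral_ofReal Iω (Eventually.of_forall fun x => sq_nonneg _)]
      refine lintegral_congr fun x => ?_
      rw [ENNReal.ofReal_pow (norm_nonneg _), ofReal_norm]
    rw [← hFl, hYl] at h
    exact (ENNReal.ofReal_le_ofReal_iff hY0).1 h
  -- ### the `y`-splitting at `R = 2Ω` (verbatim from the tree)
  set R : ℝ := 2 * Ω with hRdef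
  have hR : 0 < R := by positivity
  have hΩR : Ω ≤ R := by linarith
  have hω0 : Tendsto (curl v) (cocompact (EuclideanSpace ℝ (Fin 3))) (𝓝 0) := tendsto_curl_cocompact hv hG hB
  set lo : (EuclideanSpace ℝ (Fin 3)) → (EuclideanSpace ℝ (Fin 3)) :=
    fun y => radialCutoff R (2 * R) (curl v y) • curl v y with hlo
  set hi : (EuclideanSpace ℝ (Fin 3)) → (EuclideanSpace ℝ (Fin 3)) :=
    fun y => (1 - radialCutoff R (2 * R) (curl v y)) • curl v y with hhi
  have hlohi : ∀ y, curl v y = lo y + hi y := fun y => smul_add_one_sub_smul.symm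
  have hlo_le : ∀ y, ‖lo y‖ ≤ 2 * R := fun y => norm_lowPart_le hR y
  have hhi_le : ∀ y, ‖hi y‖ ≤ ‖curl v y‖ := fun y => norm_highPart_le_norm (curl v) R y
  have hhi1 : ContDiff ℝ 1 hi := contDiff_highPart hω1 R
  have hhic : HasCompactSupport hi := hasCompactSupport_highPart hR hω0
  have hhicont : Continuous hi := hhi1.continuous
  obtain ⟨Cl, hCl⟩ := hhi1.lipschitzWith_of_hasCompactSupport hhic one_ne_zero
  have hhol : HolderWith Cl 1 hi := hCl.holderWith
  have huhi1 : ContDiff ℝ 1 (biotSavart hi) := contDiff_biotSavart one_pos hhol hhic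
  set U : (EuclideanSpace ℝ (Fin 3)) → (EuclideanSpace ℝ (Fin 3)) := fun x => v x - biotSavart hi x with hU
  have hU1 : ContDiff ℝ 1 U := hv1.sub huhi1
  have hDU : ∀ x, fderiv ℝ U x = fderiv ℝ v x - fderiv ℝ (biotSavart hi) x := fun x =>
    fderiv_fun_sub ((hv1.differentiable one_ne_zero) x) ((huhi1.differentiable one_ne_zero) x)
  -- ### the sup bound for `U` (sees `Ω` only)
  have hhi2 : (eLpNorm hi 2 volume).toReal ≤ sY := by
    rw [← hω2]
    refine ENNReal.toReal_mono hωm2.eLpNorm_lt_top.ne (eLpNorm_mono fun y => hhi_le y)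
  set S : ℝ := 2 * (2 * R) + Cb * (eLpNorm hi 2 volume).toReal + Cv * (eLpNorm v 2 volume).toReal
    with hSdef
  have hS : ∀ x, ‖U x‖ ≤ S := fun x => hsup hv hdiv hvl2 hlohi hlo_le hhicont hhic x
  set S' : ℝ := 8 * Ω + Cb * sY + Cv * sE with hS'
  have hSS' : S ≤ S' := by
    have h1 := mul_le_mul_of_nonneg_left hhi2 hCb
    simp only [hSdef, hS']
    rw [hv2]
    linarith [h1, hRdef]
  have hS0 : 0 ≤ S := (norm_nonneg _).trans (hS 0)
  -- ### the `x`-splitting at radii `(Ωₓ, (1+η)Ωₓ)`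
  set b : ℝ := (1 + η) * Ωx with hb
  have hab : Ωx < b := by rw [hb]; nlinarith
  have hb0 : 0 < b := hΩx.trans hab
  set Z : (EuclideanSpace ℝ (Fin 3)) → (EuclideanSpace ℝ (Fin 3)) :=
    fun y => (1 - radialCutoff Ωx b (curl v y)) • curl v y with hZ
  have hZ1 : ContDiff ℝ 1 Z := contDiff_xHighPart hω1 Ωx b
  have hZc : HasCompactSupport Z := hasCompactSupport_xHighPart hΩx hab hω0
  have hZcont : Continuous Z := hZ1.continuous
  have hZle : ∀ y, ‖Z y‖ ≤ ‖curl v y‖ := fun y => norm_xHighPart_le_norm (curl v) Ωx b y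
  have hlayer : 1 + Cr * b / (b - Ωx) = cθ := by
    have hη0 : η ≠ 0 := hη.ne'
    have hden : b - Ωx = η * Ωx := by rw [hb]; ring
    rw [hden, hcθ, hb]
    field_simp
  have hDZ : ∀ y, ‖fderiv ℝ Z y‖ ≤ cθ * ‖fderiv ℝ (curl v) y‖ := fun y => by
    rw [← hlayer]
    exact norm_fderiv_xHighPart_le hω1 hCr0 hCr hΩx.le hab y
  -- ### the pointwise decomposition of the stretching density
  set wgt : (EuclideanSpace ℝ (Fin 3)) → ℝ := fun x => 1 - (1 - radialCutoff Ωx b (curl v x)) ^ 2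
    with hwgt
  set Lt : (EuclideanSpace ℝ (Fin 3)) → ℝ := fun x => wgt x * ⟪curl v x, fderiv ℝ v x (curl v x)⟫
    with hLt
  set Bt : (EuclideanSpace ℝ (Fin 3)) → ℝ := fun x => ⟪Z x, fderiv ℝ U x (Z x)⟫ with hBt
  set Gt : (EuclideanSpace ℝ (Fin 3)) → ℝ := fun x => ⟪Z x, fderiv ℝ (biotSavart hi) x (Z x)⟫ with hGt
  have hsplit : ∀ x, ⟪curl v x, fderiv ℝ v x (curl v x)⟫ = Lt x + (Bt x + Gt x) := by
    intro x
    have h1 : Bt x + Gt x = ⟪Z x, fderiv ℝ v x (Z x)⟫ := by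
      show ⟪Z x, fderiv ℝ U x (Z x)⟫ + ⟪Z x, fderiv ℝ (biotSavart hi) x (Z x)⟫ = _
      rw [← inner_add_right, hDU x, _root_.sub_apply, sub_add_cancel]
    have h2 : ⟪Z x, fderiv ℝ v x (Z x)⟫ =
        (1 - radialCutoff Ωx b (curl v x)) ^ 2 * ⟪curl v x, fderiv ℝ v x (curl v x)⟫ := by
      show ⟪(1 - radialCutoff Ωx b (curl v x)) • curl v x,
        fderiv ℝ v x ((1 - radialCutoff Ωx b (curl v x)) • curl v x)⟫ = _
      rw [map_smul, real_inner_smul_left, real_inner_smul_right]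
      ring
    rw [h1, h2]
    show _ = (1 - (1 - radialCutoff Ωx b (curl v x)) ^ 2) * ⟪curl v x, fderiv ℝ v x (curl v x)⟫ + _
    ring
  -- ### the LOW piece: Chae's pointwise bound under the value cut-off
  have hwgt01 : ∀ x, 0 ≤ wgt x ∧ wgt x ≤ 1 := fun x => lowWeight_mem_Icc Ωx b (curl v x)
  have hLt_pt : ∀ x, 2 * Lt x ≤ 2 / Real.sqrt 3 * b * frobeniusNormSq (fderiv ℝ v x) := by
    intro x
    have hrhs0 : 0 ≤ 2 / Real.sqrt 3 * b * frobeniusNormSq (fderiv ℝ v x) := by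
      have := frobeniusNormSq_nonneg (fderiv ℝ v x)
      positivity
    by_cases hθ : radialCutoff Ωx b (curl v x) = 0
    · have : Lt x = 0 := by
        show (1 - (1 - radialCutoff Ωx b (curl v x)) ^ 2) * _ = 0
        rw [hθ]; ring
      rw [this, mul_zero]; exact hrhs0
    · have hlt : ‖curl v x‖ < b := norm_lt_of_radialCutoff_ne_zero hΩx.le hab hθ
      have hchae := two_mul_inner_curl_fderiv_le_of_divergence_eq_zero (hdiv x) hlt.le
      obtain ⟨hw0, hw1⟩ := hwgt01 x
      show 2 * (wgt x * ⟪curl v x, fderiv ℝ v x (curl v x)⟫) ≤ _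
      calc 2 * (wgt x * ⟪curl v x, fderiv ℝ v x (curl v x)⟫)
          = wgt x * (2 * ⟪curl v x, fderiv ℝ v x (curl v x)⟫) := by ring
        _ ≤ wgt x * (2 / Real.sqrt 3 * b * frobeniusNormSq (fderiv ℝ v x)) :=
            mul_le_mul_of_nonneg_left hchae hw0
        _ ≤ 1 * (2 / Real.sqrt 3 * b * frobeniusNormSq (fderiv ℝ v x)) :=
            mul_le_mul_of_nonneg_right hw1 hrhs0
        _ = _ := one_mul _
  -- integrability of the three pieces
  have hLt_abs : ∀ x, |Lt x| ≤ b / 2 * (‖fderiv ℝ v x‖ ^ 2 + ‖curl v x‖ ^ 2) := by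
    intro x
    by_cases hθ : radialCutoff Ωx b (curl v x) = 0
    · have : Lt x = 0 := by
        show (1 - (1 - radialCutoff Ωx b (curl v x)) ^ 2) * _ = 0
        rw [hθ]; ring
      rw [this, abs_zero]; positivity
    · have hlt : ‖curl v x‖ < b := norm_lt_of_radialCutoff_ne_zero hΩx.le hab hθ
      obtain ⟨hw0, hw1⟩ := hwgt01 x
      have hin : |⟪curl v x, fderiv ℝ v x (curl v x)⟫| ≤ ‖curl v x‖ * (‖fderiv ℝ v x‖ * ‖curl v x‖) :=
        (abs_real_inner_le_norm _ _).trans (mul_le_mul_of_nonneg_left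
          (ContinuousLinearMap.le_opNorm _ _) (norm_nonneg _))
      show |wgt x * ⟪curl v x, fderiv ℝ v x (curl v x)⟫| ≤ _
      rw [abs_mul, abs_of_nonneg hw0]
      calc wgt x * |⟪curl v x, fderiv ℝ v x (curl v x)⟫|
          ≤ 1 * (‖curl v x‖ * (‖fderiv ℝ v x‖ * ‖curl v x‖)) :=
            mul_le_mul hw1 hin (abs_nonneg _) zero_le_one
        _ ≤ b * (‖fderiv ℝ v x‖ * ‖curl v x‖) := by
            rw [one_mul]
            exact mul_le_mul_of_nonneg_right hlt.le (by positivity)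
        _ ≤ b / 2 * (‖fderiv ℝ v x‖ ^ 2 + ‖curl v x‖ ^ 2) := by
            nlinarith [sq_nonneg (‖fderiv ℝ v x‖ - ‖curl v x‖), hb0]
  have Idom : Integrable fun x => b / 2 * (‖fderiv ℝ v x‖ ^ 2 + ‖curl v x‖ ^ 2) :=
    (hG.add Iω).const_mul (b / 2)
  have hθcont : Continuous fun x => radialCutoff Ωx b (curl v x) :=
    (radialCutoff_contDiff (E' := EuclideanSpace ℝ (Fin 3)) Ωx b (n := 1)).continuous.comp hωc
  have ILt : Integrable Lt := by
    have hcont : Continuous Lt :=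
      (continuous_const.sub ((continuous_const.sub hθcont).pow 2)).mul
        (hωc.inner (hDv.clm_apply hωc))
    refine Idom.mono' hcont.aestronglyMeasurable (Eventually.of_forall fun x => ?_)
    rw [Real.norm_eq_abs]
    exact hLt_abs x
  have hsupp_inner : ∀ (L : (EuclideanSpace ℝ (Fin 3)) → (EuclideanSpace ℝ (Fin 3)) →L[ℝ]
      (EuclideanSpace ℝ (Fin 3))), Continuous L → Integrable fun x => ⟪Z x, L x (Z x)⟫ := by
    intro L hL
    refine (hZcont.inner (hL.clm_apply hZcont)).integrable_of_hasCompactSupport ?_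
    refine hZc.mono fun x hx => ?_
    rw [mem_support] at hx ⊢
    intro h
    exact hx (by rw [h, inner_zero_left])
  have IBt : Integrable Bt := hsupp_inner _ (hU1.continuous_fderiv one_ne_zero)
  have IGt : Integrable Gt := hsupp_inner _ (huhi1.continuous_fderiv one_ne_zero)
  have IBG : Integrable fun x => Bt x + Gt x := IBt.add IGt
  have hP : ∫ x, ⟪curl v x, fderiv ℝ v x (curl v x)⟫ = (∫ x, Lt x) + ((∫ x, Bt x) + ∫ x, Gt x) := by
    rw [← integral_add IBt IGt, ← integral_add ILt IBG]
    exact integral_congr_ae (Eventually.of_forall hsplit)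
  -- ### bound of the low piece
  have hTL : 2 * ∫ x, Lt x ≤ 2 / Real.sqrt 3 * (1 + η) * Ωx * F := by
    have h1 : ∫ x, 2 * Lt x ≤ ∫ x, 2 / Real.sqrt 3 * b * frobeniusNormSq (fderiv ℝ v x) :=
      integral_mono (ILt.const_mul 2) (Ifv.const_mul _) hLt_pt
    rw [integral_const_mul, integral_const_mul] at h1
    have e : 2 / Real.sqrt 3 * b * F = 2 / Real.sqrt 3 * (1 + η) * Ωx * F := by rw [hb]; ring
    linarith
  -- ### bound of the `U`-term by integration by parts (the layer gradient bound)
  have Idom2 : Integrable fun x => (‖curl v x‖ ^ 2 + ‖fderiv ℝ (curl v) x‖ ^ 2) / 2 :=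
    (Iω.add IDω).div_const 2
  have IωDω : Integrable fun x => ‖curl v x‖ * ‖fderiv ℝ (curl v) x‖ := by
    refine Idom2.mono' (hωc.norm.mul hDω.norm).aestronglyMeasurable
      (Eventually.of_forall fun x => ?_)
    rw [Real.norm_of_nonneg (mul_nonneg (norm_nonneg _) (norm_nonneg _))]
    nlinarith [sq_nonneg (‖curl v x‖ - ‖fderiv ℝ (curl v) x‖)]
  have hTB : ∫ x, Bt x ≤ 12 * cθ * S' * sY * sD := by
    have h1 : |∫ x, Bt x| ≤ 12 * S * ∫ x, ‖Z x‖ * ‖fderiv ℝ Z x‖ :=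
      abs_integral_inner_fderiv_apply_le_of_hasCompactSupport hZ1 hZc hU1 hS
    have h2 : ∫ x, ‖Z x‖ * ‖fderiv ℝ Z x‖ ≤ cθ * ∫ x, ‖curl v x‖ * ‖fderiv ℝ (curl v) x‖ := by
      rw [← integral_const_mul]
      refine integral_mono ((hZcont.norm.mul (hZ1.continuous_fderiv one_ne_zero).norm).integrable_of_hasCompactSupport
        (hZc.norm.mul_right)) (IωDω.const_mul cθ) fun x => ?_
      show ‖Z x‖ * ‖fderiv ℝ Z x‖ ≤ cθ * (‖curl v x‖ * ‖fderiv ℝ (curl v) x‖)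
      calc ‖Z x‖ * ‖fderiv ℝ Z x‖ ≤ ‖curl v x‖ * (cθ * ‖fderiv ℝ (curl v) x‖) :=
            mul_le_mul (hZle x) (hDZ x) (norm_nonneg _) (norm_nonneg _)
        _ = cθ * (‖curl v x‖ * ‖fderiv ℝ (curl v) x‖) := by ring
    have h3 : ∫ x, ‖curl v x‖ * ‖fderiv ℝ (curl v) x‖ ≤ sY * sD :=
      (integral_norm_mul_norm_le_sqrt hωc hDω Iω IDω).trans
        (mul_le_mul_of_nonneg_left hsDop hsY0)
    have h4 : 0 ≤ ∫ x, ‖Z x‖ * ‖fderiv ℝ Z x‖ := integral_nonneg fun x => by positivity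
    calc ∫ x, Bt x ≤ |∫ x, Bt x| := le_abs_self _
      _ ≤ 12 * S * ∫ x, ‖Z x‖ * ‖fderiv ℝ Z x‖ := h1
      _ ≤ 12 * S' * (cθ * (sY * sD)) := by
          refine mul_le_mul (mul_le_mul_of_nonneg_left hSS' (by norm_num)) (h2.trans ?_) h4 (by positivity)
          exact mul_le_mul_of_nonneg_left h3 hcθ0
      _ = 12 * cθ * S' * sY * sD := by ring
  -- ### bound of the depleted term: two-threshold depletion + the Riesz count
  have hdir' : ∀ x y, Ωx < ‖curl v x‖ → Ω < ‖curl v y‖ →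
      Real.sqrt (1 - ⟪vorticityDirection (curl v) x, vorticityDirection (curl v) y⟫ ^ 2) ≤
        M * Real.sqrt ‖x - y‖ := fun x y hx hy =>
    (hdir x y hx hy).trans (mul_le_mul_of_nonneg_right hMhM (Real.sqrt_nonneg _))
  have hGpt : ∀ x, |Gt x| ≤ A * M * ‖curl v x‖ ^ 2 *
      ∫ y, ‖x - y‖ ^ (-(5 / 2 : ℝ)) * ‖(1 - radialCutoff R (2 * R) (curl v y)) • curl v y‖ :=
    fun x => hdep hω1 hR hΩR hΩx.le hab hM0 hhic hdir' x
  set t : ℝ := Real.sqrt (K * sD) with htdef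
  have ht0 : 0 ≤ t := Real.sqrt_nonneg _
  have hKsD : 0 ≤ K * sD := mul_nonneg hK0.le hsD0
  have ht2 : t ^ 2 = K * sD := Real.sq_sqrt hKsD
  have ht4 : t ^ 4 = K ^ 2 * D := by
    rw [show (4 : ℕ) = 2 * 2 by norm_num, pow_mul, ht2, mul_pow, Real.sq_sqrt hD0]
  have hTG : ∫ x, Gt x ≤ A * M * (cn * sY * t ^ 3 + cf * ((1 + sY) * sY * Y)) :=
    integral_le_of_depletedMajorant hv hG hH hA0 hM0 hhic IGt hGpt
  -- ### the final count
  have hS'0 : 0 ≤ S' := hS0.trans hSS'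
  have hS'sq : S' ^ 2 ≤ 3 * (64 * Ω ^ 2 + Cb ^ 2 * Y + Cv ^ 2 * E) := by
    have h : S' ^ 2 ≤ 3 * ((8 * Ω) ^ 2 + (Cb * sY) ^ 2 + (Cv * sE) ^ 2) := by
      rw [hS']
      nlinarith [sq_nonneg (8 * Ω - Cb * sY), sq_nonneg (Cb * sY - Cv * sE), sq_nonneg (8 * Ω - Cv * sE)]
    calc S' ^ 2 ≤ 3 * ((8 * Ω) ^ 2 + (Cb * sY) ^ 2 + (Cv * sE) ^ 2) := h
      _ = 3 * (64 * Ω ^ 2 + Cb ^ 2 * Y + Cv ^ 2 * E) := by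
          simp only [mul_pow, hsY2, hsE2]; ring
  have gE : 2 * (0 : ℝ) ≤ 8 * Ω * F + 8 * Ω * Y := by
    have : 0 ≤ 8 * Ω * F + 8 * Ω * Y := by positivity
    linarith
  have hcount := stretching_count_holder hν hK0 hA0 hM0 hcn0 hcf0 hY0 hD0 ht0 ht4 gE hTB hTG hS'sq
  have hlow : 2 / Real.sqrt 3 * (1 + η) * Ωx * F ≤ 2 / Real.sqrt 3 * (1 + η) * Ωx * Y :=
    mul_le_mul_of_nonneg_left hFY (by positivity)
  rw [hP]
  have e : 2 * ((∫ x, Lt x) + ((∫ x, Bt x) + ∫ x, Gt x)) =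
      2 * (∫ x, Lt x) + 2 * (0 + ((∫ x, Bt x) + ∫ x, Gt x)) := by ring
  rw [e]
  nlinarith [hcount, hTL, hlow, hY0, hF0]

end Summit.NavierStokesRegularity.NavierStokesRegularity.Theorems.CriticalCoherenceDoor

end
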